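import Summits.CriticalPhenomena.PercolationContinuityZ3.Theorems.PercShatteringRaceNearLinearTwoClusterDecayStubCritAspectOfTwoArm
import HarnessLib

/-!
# Crux `PercShatteringRace.NearLinearTwoClusterDecay` (stmt-CriticalPhenomena-5785) — stub W5 `stub_aspectOfTwoArmBdry`

Helper file of the line `pair-decay-long-arms-dense` (§ Unconditional frontier); lands with
`--supports stmt-CriticalPhenomena-5785` (registered stub `stub_aspectOfTwoArmBdry`).

## Statement

Bond percolation on `ℤ³` at a general parameter `p > 0`: a pair-connection lower bound
`P_p(a ↔ b inside Λ_{2n}) ≥ c n^{-e}` on `Λ_n²` (`n ≥ 1`, `e ≥ 0`) and a two-arms exponent `κ > 0`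
(`P_p(edgeTwoArms i m) ≤ C m^{-κ}`, `m ≥ 1`) give, for every aspect exponent `A > 1` with `κ A > 10 + e`,
that the crux event at exponent `A` — two sites of `Λ_n` each joined inside `Λ_N` to `∂ⁱⁿΛ_N` but not to
each other, `N = ⌈n^A⌉` — has probability tending to `0`; the union bound runs over pairs of the INNER
BOUNDARY `∂ⁱⁿΛ_n` (Cerf's own count `n^{4d-2}`: exponent `4 + 6 + e` instead of W3's `6 + 6 + e`).

## Proof sketch

Write `N = ⌈n^A⌉₊`, `P = P_p`.
* For configurations on lattice edges the crux event of `(Λ_n, Λ_N)`, `n < N`, lies in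
  `⋃_{a, b ∈ ∂ⁱⁿΛ_n} twoArmsBox n (N − n) a b` (`exists_bdry_pair_twoArmsBox`): an open path inside `Λ_N`
  from `x ∈ Λ_n` to `y ∈ ∂ⁱⁿΛ_N` (so `y ∉ Λ_n`) exits `Λ_n` through a site `a ∈ ∂ⁱⁿΛ_n` of the cluster
  of `x` (`exists_innerBoundary_reachable_of_walk`); likewise `b` for `x'`; inside `Λ_N` the clusters of
  `a, b` are those of `x, x'`: distinct, and both reach `∂ⁱⁿΛ_N`.
* Union bound, Cerf 2015 Lemma 7.1 (bond, `AKN.real_twoArmsBox_mul_le`) with middle box `Λ_{2n}`,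
  divided by `δ = c n^{-e}` (`real_twoCluster_le_of_conn`), and counted (`real_twoCluster_le_poly`:
  `|∂ⁱⁿΛ_n| ≤ 6 (2n+1)²`, `|E(Λ_{2n+1})| ≤ 6 |Λ_{2n+1}| = 6 (4n+3)³`):
  `P(crux event) ≤ 36 (2n+1)⁴ (1 + 6/p) (4n+3)⁶ · 3C (N − 2n − 2)^{−κ} / (c n^{−e})` once `2n + 3 ≤ N`.
* Real analysis (`poly_bound_bdry`, `collect_rpow_bdry`; eventually `16 n ≤ n^A` by W3's
  `NearLinearTwoClusterDecayCritAspect.eventually_one_le_and_sixteen_mul_le`, whence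
  `2n + 3 ≤ N`, `N − 2n − 2 ≥ n^A / 2`): the bound is `≤ K n^{10 + e − κA} → 0` as `κA > 10 + e`
  (`tendsto_rpow_neg_atTop`, `squeeze_zero'`).

## References

* R. Cerf, *A lower bound on the two-arms exponent for critical percolation on the lattice*, Ann. Probab. 43
  (2015), §7, Lemma 7.1 and Corollary 7.2 (arXiv:1306.3105 pp. 11–13) [Cerf2015].
-/

noncomputable section

namespace Summit.CriticalPhenomena.PercolationContinuityZ3.Theorems

namespace NearLinearTwoClusterDecayAspectBdry

open MeasureTheory Filter Topology
open Literature.Probability.LatticeModels Literature.Probability.Percolation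

variable {d : ℕ}

/-! ## The crux event through boundary pairs of the inner box -/

/-- **Exit through the inner boundary**: if `x ∈ Λ_k` is joined by an open path inside `Λ_m` (`k < m`)
to a site of `∂ⁱⁿΛ_m` (which lies outside `Λ_k`, having a coordinate `± m`), then `x` is so joined to a
site of `∂ⁱⁿΛ_k` (the exit point of the path from `Λ_k`). [folklore] -/
theorem exists_innerBoundary_reachable {k m : ℕ} (hkm : k < m) {ω : BondConfig (Site d)}
    {x y : Site d} (hx : x ∈ box d k) (hy : y ∈ innerBoundary (zdGraph d) (box d m))
    (hxy : (openGraph ω ⊓ withinGraph (zdGraph d) ↑(box d m)).Reachable x y) :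
    ∃ a ∈ innerBoundary (zdGraph d) (box d k),
      (openGraph ω ⊓ withinGraph (zdGraph d) ↑(box d m)).Reachable x a := by
  obtain ⟨w⟩ := hxy
  have hyk : y ∉ box d k := fun hyk => by
    obtain ⟨i, hi⟩ := exists_eq_of_mem_innerBoundary_box hy
    have h := (mem_box.1 hyk) i
    omega
  obtain ⟨a, ha, hxΛ, haΛ, hreach⟩ := exists_innerBoundary_reachable_of_walk
    (inf_le_right.trans (withinGraph_le _ _)) (box d k) w hx hyk
  exact ⟨a, ha, hreach.map (SimpleGraph.Embedding.induce (↑(box d k) : Set (Site d))).toHom⟩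

/-- **The crux event through boundary pairs** (Cerf 2015, Cor. 7.2, with the pair taken on `∂ⁱⁿΛ_n`):
for a configuration on lattice edges, if `x, x' ∈ Λ_n` are joined inside `Λ_{n+ℓ}` (`ℓ ≥ 1`) to
`∂ⁱⁿΛ_{n+ℓ}` but not to each other, then `twoArmsBox n ℓ a b` occurs for some `a, b ∈ ∂ⁱⁿΛ_n` (the exit
points of the two open paths from `Λ_n`; clusters inside `Λ_{n+ℓ}` are reachability classes).
[cite: Cerf2015, Cor 7.2] -/
theorem exists_bdry_pair_twoArmsBox {n ℓ : ℕ} (hℓ : 0 < ℓ) {ω : BondConfig (Site d)}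
    (hω : ω ⊆ (zdGraph d).edgeSet) {x x' y y' : Site d} (hx : x ∈ box d n) (hx' : x' ∈ box d n)
    (hy : y ∈ innerBoundary (zdGraph d) (box d (n + ℓ)))
    (hy' : y' ∈ innerBoundary (zdGraph d) (box d (n + ℓ)))
    (hxy : ω ∈ openConnIn ↑(box d (n + ℓ)) x y) (hx'y' : ω ∈ openConnIn ↑(box d (n + ℓ)) x' y')
    (hxx' : ω ∉ openConnIn ↑(box d (n + ℓ)) x x') :
    ∃ a ∈ innerBoundary (zdGraph d) (box d n), ∃ b ∈ innerBoundary (zdGraph d) (box d n),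
      ω ∈ AKN.twoArmsBox n ℓ a b := by
  have hnℓ : n < n + ℓ := by omega
  have hsub : box d n ⊆ box d (n + ℓ) := box_mono d hnℓ.le
  -- `openConnIn` (tree) is reachability in `openGraph ω ⊓ withinGraph ℤ^d Λ_{n+ℓ}` for `ω ⊆ E(ℤ^d)`
  have key : ∀ {a b : Site d}, a ∈ box d (n + ℓ) → (ω ∈ openConnIn ↑(box d (n + ℓ)) a b ↔
      (openGraph ω ⊓ withinGraph (zdGraph d) ↑(box d (n + ℓ))).Reachable a b) := by
    intro a b ha
    rw [openConnIn_eq_openConnVia (Finset.mem_coe.2 ha), ← mem_openClusterIn_iff,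
      openClusterIn_withinGraph_eq_top (zdGraph d) _ hω]
    exact Iff.rfl
  have hxyR := (key (hsub hx)).1 hxy
  have hx'y'R := (key (hsub hx')).1 hx'y'
  obtain ⟨a, ha, haR⟩ := exists_innerBoundary_reachable hnℓ hx hy hxyR
  obtain ⟨b, hb, hbR⟩ := exists_innerBoundary_reachable hnℓ hx' hy' hx'y'R
  refine ⟨a, ha, b, hb, ?_⟩
  simp only [AKN.twoArmsBox, AKN.Reaches, Set.mem_setOf_eq, mem_openClusterIn_iff]
  exact ⟨fun hab => hxx' ((key (hsub hx)).2 ((haR.trans hab).trans hbR.symm)),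
    ⟨y, hy, haR.symm.trans hxyR⟩, ⟨y', hy', hbR.symm.trans hx'y'R⟩⟩

/-! ## Union bound over boundary pairs, Lemma 7.1, and the count -/

/-- **Cerf 2015, Cor. 7.2 (union bound over BOUNDARY pairs) + Lemma 7.1 (bond), divided by a
pair-connection lower bound.** For `k + 3 ≤ ℓ`, `p > 0` and `δ > 0` with `δ ≤ P_p(a ↔ b inside Λ_{n+k})`
for all `a, b ∈ Λ_n`: the crux event of `(Λ_n, Λ_{n+ℓ})` has probability at most
`|∂ⁱⁿΛ_n|² (1 + |E(Λ_{n+k+1})|/p) |Λ_{n+k+1}| (Σ_i P_p(edgeTwoArms i (ℓ−k−2))) / δ`.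
[cite: Cerf2015, Lemma 7.1 and Cor 7.2] -/
theorem real_twoCluster_le_of_conn (p : unitInterval) (hp0 : 0 < (p : ℝ)) {n k ℓ : ℕ}
    (hkℓ : k + 3 ≤ ℓ) {δ : ℝ} (hδ : 0 < δ)
    (hq : ∀ a ∈ box d n, ∀ b ∈ box d n,
      δ ≤ (bondPercolation (zdGraph d) p).real (openConnIn (↑(box d (n + k)) : Set (Site d)) a b)) :
    (bondPercolation (zdGraph d) p).real
      {ω | ∃ x ∈ box d n, ∃ x' ∈ box d n, ∃ y ∈ innerBoundary (zdGraph d) (box d (n + ℓ)),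
        ∃ y' ∈ innerBoundary (zdGraph d) (box d (n + ℓ)),
          ω ∈ openConnIn ↑(box d (n + ℓ)) x y ∧ ω ∈ openConnIn ↑(box d (n + ℓ)) x' y' ∧
          ω ∉ openConnIn ↑(box d (n + ℓ)) x x'} ≤
      ((innerBoundary (zdGraph d) (box d n)).card : ℝ) ^ 2 *
        ((1 + (edgesIn (zdGraph d) (box d (n + k + 1))).card / p) *
        ((box d (n + k + 1)).card *
          ∑ i : Fin d, (bondPercolation (zdGraph d) p).real (AKN.edgeTwoArms i (ℓ - k - 2)))) / δ := by
  set μ := bondPercolation (zdGraph d) p with hμ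
  obtain ⟨Rf, hRf⟩ : ∃ Rf : ℝ, Rf = (1 + (edgesIn (zdGraph d) (box d (n + k + 1))).card / p) *
      ((box d (n + k + 1)).card * ∑ i : Fin d, μ.real (AKN.edgeTwoArms i (ℓ - k - 2))) := ⟨_, rfl⟩
  rw [← hRf]
  have hvia : ∀ a ∈ box d n, ∀ b ∈ box d n,
      δ ≤ μ.real (openConnVia (withinGraph (zdGraph d) (↑(box d (n + k)) : Set (Site d))) a b) := by
    intro a ha b hb
    refine (hq a ha b hb).trans
      (DCT16.real_mono_of_forall_subset_edgeSet (zdGraph d) p fun ω hω h => ?_)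
    have ha' : a ∈ (↑(box d (n + k)) : Set (Site d)) :=
      Finset.mem_coe.2 (box_mono d (Nat.le_add_right n k) ha)
    rw [openConnIn_eq_openConnVia ha'] at h
    rw [openConnVia, Set.mem_setOf_eq, openClusterIn_withinGraph_eq_top (zdGraph d) _ hω]
    exact h
  -- Lemma 7.1 per pair, divided by `δ`
  have hpair : ∀ a ∈ box d n, ∀ b ∈ box d n, μ.real (AKN.twoArmsBox n ℓ a b) ≤ Rf / δ := by
    intro a ha b hb
    have h71 := AKN.real_twoArmsBox_mul_le p hp0 (n := n) (k := k) hkℓ ha hb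
    rw [← hRf] at h71
    rw [le_div_iff₀ hδ]
    calc μ.real (AKN.twoArmsBox n ℓ a b) * δ ≤ μ.real (AKN.twoArmsBox n ℓ a b) *
          μ.real (openConnVia (withinGraph (zdGraph d) (↑(box d (n + k)) : Set (Site d))) a b) :=
          mul_le_mul_of_nonneg_left (hvia a ha b hb) measureReal_nonneg
      _ ≤ Rf := h71
  calc μ.real
        {ω | ∃ x ∈ box d n, ∃ x' ∈ box d n, ∃ y ∈ innerBoundary (zdGraph d) (box d (n + ℓ)),
          ∃ y' ∈ innerBoundary (zdGraph d) (box d (n + ℓ)),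
            ω ∈ openConnIn ↑(box d (n + ℓ)) x y ∧ ω ∈ openConnIn ↑(box d (n + ℓ)) x' y' ∧
            ω ∉ openConnIn ↑(box d (n + ℓ)) x x'}
      ≤ μ.real (⋃ a ∈ innerBoundary (zdGraph d) (box d n), ⋃ b ∈ innerBoundary (zdGraph d) (box d n),
          AKN.twoArmsBox n ℓ a b) := by
        refine DCT16.real_mono_of_forall_subset_edgeSet (zdGraph d) p fun ω hω h => ?_
        obtain ⟨x, hx, x', hx', y, hy, y', hy', hxy, hx'y', hxx'⟩ := h
        obtain ⟨a, ha, b, hb, hab⟩ :=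
          exists_bdry_pair_twoArmsBox (by omega) hω hx hx' hy hy' hxy hx'y' hxx'
        exact Set.mem_iUnion₂.2 ⟨a, ha, Set.mem_iUnion₂.2 ⟨b, hb, hab⟩⟩
    _ ≤ ∑ a ∈ innerBoundary (zdGraph d) (box d n),
          μ.real (⋃ b ∈ innerBoundary (zdGraph d) (box d n), AKN.twoArmsBox n ℓ a b) :=
        measureReal_biUnion_finset_le _ _
    _ ≤ ∑ _a ∈ innerBoundary (zdGraph d) (box d n), ∑ _b ∈ innerBoundary (zdGraph d) (box d n),
          Rf / δ :=
        Finset.sum_le_sum fun a ha => (measureReal_biUnion_finset_le _ _).trans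
          (Finset.sum_le_sum fun b hb =>
            hpair a (mem_innerBoundary_iff.1 ha).1 b (mem_innerBoundary_iff.1 hb).1)
    _ = ((innerBoundary (zdGraph d) (box d n)).card : ℝ) ^ 2 * Rf / δ := by
        rw [Finset.sum_const, Finset.sum_const, nsmul_eq_mul, nsmul_eq_mul]; ring

/-- **The counted form on `ℤ³`.** With a two-arms exponent `κ` (`P_p(edgeTwoArms i m) ≤ C m^{-κ}`,
`m ≥ 1`), `n ≤ m`, `m + 3 ≤ M` and `δ ≤ P_p(a ↔ b inside Λ_m)` on `Λ_n²`: the crux event of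
`(Λ_n, Λ_M)` has probability at most `36 (2n+1)⁴ (1 + 6/p) (2m+3)⁶ · 3C (M−m−2)^{−κ} / δ`
(`|∂ⁱⁿΛ_n| ≤ 6 (2n+1)²`, `|Λ_{m+1}| = (2m+3)³`, `|E(Λ_{m+1})| ≤ 6 |Λ_{m+1}|`, three directions).
[cite: Cerf2015, Lemma 7.1 and Cor 7.2] -/
theorem real_twoCluster_le_poly (p : unitInterval) (hp0 : 0 < (p : ℝ)) {C κ δ : ℝ}
    (hδ : 0 < δ) (hC : ∀ i : Fin 3, ∀ m : ℕ, 1 ≤ m →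
      (bondPercolation (zdGraph 3) p).real (AKN.edgeTwoArms i m) ≤ C * (m : ℝ) ^ (-κ))
    {n m M : ℕ} (hnm : n ≤ m) (hmM : m + 3 ≤ M)
    (hq : ∀ a ∈ box 3 n, ∀ b ∈ box 3 n,
      δ ≤ (bondPercolation (zdGraph 3) p).real (openConnIn (↑(box 3 m) : Set (Site 3)) a b)) :
    (bondPercolation (zdGraph 3) p).real
      {ω | ∃ x ∈ box 3 n, ∃ x' ∈ box 3 n, ∃ y ∈ innerBoundary (zdGraph 3) (box 3 M),
        ∃ y' ∈ innerBoundary (zdGraph 3) (box 3 M),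
          ω ∈ openConnIn ↑(box 3 M) x y ∧ ω ∈ openConnIn ↑(box 3 M) x' y' ∧
          ω ∉ openConnIn ↑(box 3 M) x x'} ≤
      36 * (2 * (n : ℝ) + 1) ^ 4 * ((1 + 6 / (p : ℝ)) * (2 * (m : ℝ) + 3) ^ 6 *
        (3 * C * ((M : ℝ) - m - 2) ^ (-κ))) / δ := by
  set μ := bondPercolation (zdGraph 3) p with hμ
  obtain ⟨k, hk⟩ : ∃ k, m = n + k := ⟨m - n, by omega⟩
  obtain ⟨ℓ, hℓ⟩ : ∃ ℓ, M = n + ℓ := ⟨M - n, by omega⟩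
  have hkℓ : k + 3 ≤ ℓ := by omega
  have hj1 : 1 ≤ ℓ - k - 2 := by omega
  have hcast : (((ℓ - k - 2 : ℕ)) : ℝ) = (M : ℝ) - m - 2 := by
    have h : ℓ - k - 2 + m + 2 = M := by omega
    have h' : (((ℓ - k - 2 : ℕ)) : ℝ) + m + 2 = M := by exact_mod_cast h
    linarith
  obtain ⟨t, ht⟩ : ∃ t : ℝ, t = (M : ℝ) - m - 2 := ⟨_, rfl⟩
  rw [← ht] at hcast ⊢
  have ht0 : 0 < t := by
    rw [← hcast]; exact_mod_cast hj1
  obtain ⟨B, hB⟩ : ∃ B : ℝ, B = 2 * (m : ℝ) + 3 := ⟨_, rfl⟩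
  rw [← hB]
  have hB1 : 1 ≤ B := by rw [hB]; linarith [(Nat.cast_nonneg m : (0 : ℝ) ≤ m)]
  have hB0 : 0 ≤ B := by linarith
  subst hk
  subst hℓ
  have hA := real_twoCluster_le_of_conn p hp0 hkℓ hδ hq
  refine hA.trans (div_le_div_of_nonneg_right ?_ hδ.le)
  have hcard1 : ((innerBoundary (zdGraph 3) (box 3 n)).card : ℝ) ^ 2 ≤ 36 * (2 * (n : ℝ) + 1) ^ 4 := by
    have h := card_innerBoundary_box_le (d := 3) n
    have h' : ((innerBoundary (zdGraph 3) (box 3 n)).card : ℝ) ≤ 6 * (2 * (n : ℝ) + 1) ^ 2 := by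
      have h2 : (2 * 3 * (2 * n + 1) ^ (3 - 1) : ℕ) = 6 * (2 * n + 1) ^ 2 := by norm_num
      rw [h2] at h
      exact_mod_cast h
    calc ((innerBoundary (zdGraph 3) (box 3 n)).card : ℝ) ^ 2 ≤ (6 * (2 * (n : ℝ) + 1) ^ 2) ^ 2 :=
        pow_le_pow_left₀ (Nat.cast_nonneg _) h' 2
      _ = 36 * (2 * (n : ℝ) + 1) ^ 4 := by ring
  have hcard2 : ((box 3 (n + k + 1)).card : ℝ) = B ^ 3 := by
    rw [card_box, hB]; push_cast; ring
  have hE : ((edgesIn (zdGraph 3) (box 3 (n + k + 1))).card : ℝ) ≤ 6 * B ^ 3 := by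
    have h := AKN.card_edgesIn_le (d := 3) (box 3 (n + k + 1))
    have h' : ((edgesIn (zdGraph 3) (box 3 (n + k + 1))).card : ℝ) ≤
        2 * 3 * ((box 3 (n + k + 1)).card : ℝ) := by exact_mod_cast h
    rw [hcard2] at h'
    linarith
  have hS0 : 0 ≤ ∑ i : Fin 3, μ.real (AKN.edgeTwoArms i (ℓ - k - 2)) :=
    Finset.sum_nonneg fun _ _ => measureReal_nonneg
  have hS : ∑ i : Fin 3, μ.real (AKN.edgeTwoArms i (ℓ - k - 2)) ≤ 3 * C * t ^ (-κ) := by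
    rw [← hcast]
    calc ∑ i : Fin 3, μ.real (AKN.edgeTwoArms i (ℓ - k - 2))
        ≤ ∑ _i : Fin 3, C * (((ℓ - k - 2 : ℕ)) : ℝ) ^ (-κ) :=
          Finset.sum_le_sum fun i _ => hC i _ hj1
      _ = 3 * C * (((ℓ - k - 2 : ℕ)) : ℝ) ^ (-κ) := by
          rw [Finset.sum_const, Finset.card_univ, Fintype.card_fin, nsmul_eq_mul]; push_cast; ring
  have h1 : 1 + ((edgesIn (zdGraph 3) (box 3 (n + k + 1))).card : ℝ) / p ≤ (1 + 6 / (p : ℝ)) * B ^ 3 := by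
    have h2 : ((edgesIn (zdGraph 3) (box 3 (n + k + 1))).card : ℝ) / p ≤ 6 * B ^ 3 / p :=
      div_le_div_of_nonneg_right hE hp0.le
    have hB3 : 1 ≤ B ^ 3 := one_le_pow₀ hB1
    calc 1 + ((edgesIn (zdGraph 3) (box 3 (n + k + 1))).card : ℝ) / p ≤ 1 + 6 * B ^ 3 / p := by
          linarith
      _ ≤ B ^ 3 + 6 * B ^ 3 / p := by linarith
      _ = (1 + 6 / (p : ℝ)) * B ^ 3 := by ring
  rw [hcard2]
  refine mul_le_mul hcard1 ?_ (mul_nonneg (by positivity) (mul_nonneg (by positivity) hS0))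
    (by positivity)
  calc (1 + ((edgesIn (zdGraph 3) (box 3 (n + k + 1))).card : ℝ) / p) *
        (B ^ 3 * ∑ i : Fin 3, μ.real (AKN.edgeTwoArms i (ℓ - k - 2)))
      ≤ ((1 + 6 / (p : ℝ)) * B ^ 3) * (B ^ 3 * (3 * C * t ^ (-κ))) :=
        mul_le_mul h1 (mul_le_mul_of_nonneg_left hS (by positivity)) (mul_nonneg (by positivity) hS0)
          (by positivity)
    _ = (1 + 6 / (p : ℝ)) * B ^ 6 * (3 * C * t ^ (-κ)) := by ring

/-! ## Real analysis -/

/-- **The polynomial count against the scales** (boundary-pairs version). For `U ≥ 1`,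
`1 ≤ P ≤ mr ≤ P + 1`, `Q ≤ Mr`, `8P ≤ Q`, `q, C ≥ 0`, `δ > 0`, `κ ≥ 0`:
`36 (2U+1)⁴ q (2 mr + 3)⁶ · 3C (Mr − mr − 2)^{−κ} / δ ≤ (36 · 3⁴ 7⁶ · 3 · 2^κ q C / δ) · U⁴ P⁶ Q^{−κ}`
(`2U+1 ≤ 3U`, `2mr+3 ≤ 7P`, `Mr − mr − 2 ≥ Q/2`). [folklore] -/
theorem poly_bound_bdry {U P Q mr Mr q C δ κ : ℝ} (hU : 1 ≤ U) (hP1 : 1 ≤ P) (hm1 : P ≤ mr)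
    (hm2 : mr ≤ P + 1) (hM1 : Q ≤ Mr) (h8 : 8 * P ≤ Q) (hq : 0 ≤ q) (hC : 0 ≤ C) (hδ : 0 < δ)
    (hκ : 0 ≤ κ) :
    36 * (2 * U + 1) ^ 4 * (q * (2 * mr + 3) ^ 6 * (3 * C * (Mr - mr - 2) ^ (-κ))) / δ ≤
      36 * 3 ^ 4 * 7 ^ 6 * 3 * 2 ^ κ * q * C / δ * (U ^ (4 : ℕ) * P ^ (6 : ℕ) * Q ^ (-κ)) := by
  have hQ2 : 0 < Q / 2 := by linarith
  have ht : Q / 2 ≤ Mr - mr - 2 := by linarith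
  have h1 : (2 * U + 1) ^ 4 ≤ (3 * U) ^ 4 := pow_le_pow_left₀ (by linarith) (by linarith) 4
  have h2 : (2 * mr + 3) ^ 6 ≤ (7 * P) ^ 6 := pow_le_pow_left₀ (by linarith) (by linarith) 6
  have h3 : (Mr - mr - 2) ^ (-κ) ≤ (Q / 2) ^ (-κ) := Real.rpow_le_rpow_of_nonpos hQ2 ht (by linarith)
  have h4 : (Q / 2) ^ (-κ) = 2 ^ κ * Q ^ (-κ) := by
    rw [Real.div_rpow (by linarith) (by norm_num), Real.rpow_neg (by norm_num : (0 : ℝ) ≤ 2) κ,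
      div_inv_eq_mul, mul_comm]
  have h0 : 0 ≤ (Mr - mr - 2) ^ (-κ) := Real.rpow_nonneg (by linarith) _
  have hP0 : 0 < P := by linarith
  have hU0 : 0 < U := by linarith
  have hmr0 : 0 ≤ 2 * mr + 3 := by linarith
  have h3C : 0 ≤ 3 * C * (Mr - mr - 2) ^ (-κ) := mul_nonneg (mul_nonneg (by norm_num) hC) h0
  have hX : q * (2 * mr + 3) ^ 6 * (3 * C * (Mr - mr - 2) ^ (-κ)) ≤
      q * (7 * P) ^ 6 * (3 * C * (Q / 2) ^ (-κ)) :=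
    mul_le_mul (mul_le_mul_of_nonneg_left h2 hq)
      (mul_le_mul_of_nonneg_left h3 (mul_nonneg (by norm_num) hC)) h3C (by positivity)
  have hY : 36 * (2 * U + 1) ^ 4 * (q * (2 * mr + 3) ^ 6 * (3 * C * (Mr - mr - 2) ^ (-κ))) ≤
      36 * (3 * U) ^ 4 * (q * (7 * P) ^ 6 * (3 * C * (Q / 2) ^ (-κ))) :=
    mul_le_mul (mul_le_mul_of_nonneg_left h1 (by norm_num)) hX
      (mul_nonneg (mul_nonneg hq (pow_nonneg hmr0 6)) h3C) (by positivity)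
  calc 36 * (2 * U + 1) ^ 4 * (q * (2 * mr + 3) ^ 6 * (3 * C * (Mr - mr - 2) ^ (-κ))) / δ
      ≤ 36 * (3 * U) ^ 4 * (q * (7 * P) ^ 6 * (3 * C * (Q / 2) ^ (-κ))) / δ :=
        div_le_div_of_nonneg_right hY hδ.le
    _ = 36 * 3 ^ 4 * 7 ^ 6 * 3 * 2 ^ κ * q * C / δ * (U ^ (4 : ℕ) * P ^ (6 : ℕ) * Q ^ (-κ)) := by
        rw [h4]; ring

/-- **Collecting the powers** against the pair-connection lower bound `δ = c t^{-e}`: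
`(36 · 3⁴ 7⁶ 3 · 2^κ q C / (c t^{−e})) · t⁴ (2t)⁶ (t^A)^{−κ} = (36 · 3⁴ 7⁶ 3 · 2^κ q C 2⁶ / c) · t^{10 + e − κA}`
for `t > 0`. [folklore] -/
theorem collect_rpow_bdry {t c e κ A q C : ℝ} (ht : 0 < t) :
    36 * 3 ^ 4 * 7 ^ 6 * 3 * 2 ^ κ * q * C / (c * t ^ (-e)) *
        (t ^ (4 : ℕ) * (2 * t) ^ (6 : ℕ) * (t ^ A) ^ (-κ)) =
      36 * 3 ^ 4 * 7 ^ 6 * 3 * 2 ^ κ * q * C * 2 ^ 6 / c * t ^ (10 + e - κ * A) := by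
  have e1 : t ^ (-e) = (t ^ e)⁻¹ := Real.rpow_neg ht.le e
  have e2 : (t ^ A) ^ (-κ) = t ^ (-(κ * A)) := by
    rw [← Real.rpow_mul ht.le]; congr 1; ring
  have e3 : t ^ (10 + e - κ * A) = t ^ (10 : ℕ) * t ^ e * t ^ (-(κ * A)) := by
    rw [sub_eq_add_neg, Real.rpow_add ht, Real.rpow_add ht]
    congr 2
    exact_mod_cast Real.rpow_natCast t 10
  rw [e1, e2, e3]
  simp only [div_eq_mul_inv, mul_inv, inv_inv]
  ring

end NearLinearTwoClusterDecayAspectBdry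

open MeasureTheory Filter Topology
open Literature.Probability.LatticeModels Literature.Probability.Percolation
open NearLinearTwoClusterDecayAspectBdry NearLinearTwoClusterDecayCritAspect

/-- **Stub W5 `stub_aspectOfTwoArmBdry` of the line `pair-decay-long-arms-dense`** (registered; § Unconditional
frontier, the lossy step at a general parameter with BOUNDARY pairs): for bond percolation on `ℤ³` at any
`p > 0`, a pair-connection lower bound `P_p(a ↔ b inside Λ_{2n}) ≥ c n^{-e}` on `Λ_n²` (`e ≥ 0`) and a
two-arms exponent `κ` give two-cluster decay at every aspect exponent `A > 1` with `κ A > 10 + e` — the crux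
event of `(Λ_n, Λ_N)` forces `twoArmsBox n (N − n) a b` for a pair `a, b ∈ ∂ⁱⁿΛ_n` (exit points), then
Cerf 2015 Lemma 7.1 (bond) with middle box `Λ_{2n}` and the count
`36 (2n+1)⁴ (1 + 6/p)(4n+3)⁶ · 3C (N − 2n − 2)^{−κ} / (c n^{−e}) ≤ K n^{10 + e − κA} → 0`.
[cite: Cerf2015, Lemma 7.1 and Cor 7.2] -/
theorem stub_aspectOfTwoArmBdry :
    ∀ p : unitInterval, 0 < (p : ℝ) → ∀ e : ℝ, 0 ≤ e →
    (∃ c : ℝ, 0 < c ∧ ∀ n : ℕ, 1 ≤ n → ∀ a ∈ box 3 n, ∀ b ∈ box 3 n,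
      c * (n : ℝ) ^ (-e) ≤
        (bondPercolation (zdGraph 3) p).real (openConnIn (↑(box 3 (2 * n)) : Set (Site 3)) a b)) →
    ∀ κ : ℝ, 0 < κ →
    (∃ C : ℝ, ∀ i : Fin 3, ∀ m : ℕ, 1 ≤ m →
      (bondPercolation (zdGraph 3) p).real (AKN.edgeTwoArms i m) ≤ C * (m : ℝ) ^ (-κ)) →
    ∀ A : ℝ, 1 < A → 10 + e < κ * A →
    Filter.Tendsto (fun n : ℕ => (bondPercolation (zdGraph 3) p).real
      {ω | ∃ x ∈ box 3 n, ∃ x' ∈ box 3 n, ∃ y ∈ innerBoundary (zdGraph 3) (box 3 ⌈(n : ℝ) ^ A⌉₊),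
        ∃ y' ∈ innerBoundary (zdGraph 3) (box 3 ⌈(n : ℝ) ^ A⌉₊),
          ω ∈ openConnIn ↑(box 3 ⌈(n : ℝ) ^ A⌉₊) x y ∧
          ω ∈ openConnIn ↑(box 3 ⌈(n : ℝ) ^ A⌉₊) x' y' ∧
          ω ∉ openConnIn ↑(box 3 ⌈(n : ℝ) ^ A⌉₊) x x'}) Filter.atTop (nhds 0) := by
  intro p hp0 e _he hW1 κ hκ hTA A hA1 hκA
  obtain ⟨c, hc, hW⟩ := hW1
  obtain ⟨C, hC⟩ := hTA
  have hC0 : 0 ≤ C := by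
    have h := hC 0 1 le_rfl
    rw [Nat.cast_one, Real.one_rpow, mul_one] at h
    exact measureReal_nonneg.trans h
  obtain ⟨q, hq⟩ : ∃ q : ℝ, q = 1 + 6 / (p : ℝ) := ⟨_, rfl⟩
  have hq0 : 0 ≤ q := by rw [hq]; positivity
  obtain ⟨K, hK⟩ : ∃ K : ℝ, K = 36 * 3 ^ 4 * 7 ^ 6 * 3 * 2 ^ κ * q * C * 2 ^ 6 / c := ⟨_, rfl⟩
  have hlim : Tendsto (fun n : ℕ => K * (n : ℝ) ^ (10 + e - κ * A)) atTop (𝓝 0) := by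
    have h1 : Tendsto (fun n : ℕ => (n : ℝ) ^ (10 + e - κ * A)) atTop (𝓝 0) := by
      have e' : 10 + e - κ * A = -(κ * A - 10 - e) := by ring
      rw [e']
      exact (tendsto_rpow_neg_atTop (by linarith)).comp tendsto_natCast_atTop_atTop
    simpa only [mul_zero] using h1.const_mul K
  refine squeeze_zero' (Eventually.of_forall fun n => measureReal_nonneg) ?_ hlim
  -- at a good scale `n` (`1 ≤ n`, `16 n ≤ n^A ≤ N`, W3's `eventually_one_le_and_sixteen_mul_le`)
  filter_upwards [eventually_one_le_and_sixteen_mul_le hA1] with n ⟨hn1, h16⟩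
  have hU1 : (1 : ℝ) ≤ n := Nat.one_le_cast.2 hn1
  have hU0 : (0 : ℝ) < n := by linarith
  have hδ : 0 < c * (n : ℝ) ^ (-e) := mul_pos hc (Real.rpow_pos_of_pos hU0 _)
  have hmr : ((2 * n : ℕ) : ℝ) = 2 * (n : ℝ) := by push_cast; ring
  have hM1 : (n : ℝ) ^ A ≤ (⌈(n : ℝ) ^ A⌉₊ : ℕ) := Nat.le_ceil _
  have hmM : 2 * n + 3 ≤ ⌈(n : ℝ) ^ A⌉₊ := by
    have h : ((2 * n : ℕ) : ℝ) + 3 ≤ (⌈(n : ℝ) ^ A⌉₊ : ℕ) := by rw [hmr]; linarith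
    exact_mod_cast h
  calc (bondPercolation (zdGraph 3) p).real
        {ω | ∃ x ∈ box 3 n, ∃ x' ∈ box 3 n, ∃ y ∈ innerBoundary (zdGraph 3) (box 3 ⌈(n : ℝ) ^ A⌉₊),
          ∃ y' ∈ innerBoundary (zdGraph 3) (box 3 ⌈(n : ℝ) ^ A⌉₊),
            ω ∈ openConnIn ↑(box 3 ⌈(n : ℝ) ^ A⌉₊) x y ∧
            ω ∈ openConnIn ↑(box 3 ⌈(n : ℝ) ^ A⌉₊) x' y' ∧
            ω ∉ openConnIn ↑(box 3 ⌈(n : ℝ) ^ A⌉₊) x x'}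
      ≤ 36 * (2 * (n : ℝ) + 1) ^ 4 * ((1 + 6 / (p : ℝ)) *
          (2 * ((2 * n : ℕ) : ℝ) + 3) ^ 6 *
            (3 * C * (((⌈(n : ℝ) ^ A⌉₊ : ℕ) : ℝ) - ((2 * n : ℕ) : ℝ) - 2) ^ (-κ))) /
          (c * (n : ℝ) ^ (-e)) :=
        real_twoCluster_le_poly p hp0 hδ hC (by omega) hmM (hW n hn1)
    _ ≤ 36 * 3 ^ 4 * 7 ^ 6 * 3 * 2 ^ κ * q * C / (c * (n : ℝ) ^ (-e)) *
          ((n : ℝ) ^ (4 : ℕ) * (2 * (n : ℝ)) ^ (6 : ℕ) * ((n : ℝ) ^ A) ^ (-κ)) := by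
        rw [hq]
        exact poly_bound_bdry hU1 (by linarith) hmr.ge (by rw [hmr]; linarith) hM1 (by linarith)
          (hq ▸ hq0) hC0 hδ hκ.le
    _ = K * (n : ℝ) ^ (10 + e - κ * A) := by rw [hK]; exact collect_rpow_bdry hU0

end Summit.CriticalPhenomena.PercolationContinuityZ3.Theorems
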